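import Summits.Ventures.HSemireg.WeilFrameBidegree
import Summits.Ventures.HSemireg.WeilFrameWeilLines
import Literature.AlgebraicGeometry.HodgeTheory.AbelianVarietyHodgeNumbers

/-!
# Venture HSemireg — the polarisation 2-vector from its two geometric properties: a `K`-SYMMETRIC class of HODGE TYPE `(1,1)`
# read in `ΛH¹` lies in the span of the Weil generating set; THEOREM R on the real carriers with `h` by its properties

HONEST FRAMING. Part of the Lean index of the computation cell `pub-hsemireg` (seat w3-mod4-1 gen 8, W3 SPECIAL FIBRES,
MOD4-OFFSPLIT §13). The tree's real carriers and Literature layers (`DegreeOneHodgeTypes`: `V_μ = V_μ^{1,0} ⊕ V_μ^{0,1}`;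
`AbelianVarietyHodgeNumbers`: `H^{p,q}(A)` is the span of the typed wedges; `AbelianVarietyEndomorphismsHOne`: `H¹ = V₊ ⊕ V₋`;
`AbelianVarietyCohomologyExteriorH1`: `⋀ᵈ H¹ ≃ Hᵈ` is natural) ONLY: no semiregularity map is constructed; nothing here says that
HC / HC_CM / HC_AV holds; nothing here is a claim about any explicit variety; no Literature fact is declared; NO definition is
introduced. The NON-DEGENERACY of the polarisation 2-vector on `(H^{0,1})^⊥` stays a hypothesis (`hnd`).

WHAT IS PROVED. For a complex abelian variety `A` with `φ ≫ φ = -(d • 𝟙 A)`, `d ≥ 1`, `P = V₊`, `Q = V₋` the `± i√d`-eigenspaces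
of `φ^*` on `H¹(A; ℂ)`, and a class `h ∈ H²(A(ℂ); ℂ)` that is `K`-SYMMETRIC (`φ^* h = d·h` — the tree's hypothesis shape of
`WeilClassesPolarizationOrthogonal`, «`E(φu, φv) = d·E(u, v)`») and of HODGE TYPE `(1,1)` (`IsOfHodgeType A.dim A.X 2 1 1 h`):
**`exteriorOf_mem_span_weilGen`** — `h` read in `ΛH¹` (`(⋀²).subtype ∘ (equiv A 2)⁻¹`, as `totalExteriorClass` reads it) lies in
the span of the Weil generating set `{ι x · ι l : (x ∈ V₊, l ∈ H^{0,1} ⊓ V₋) or (x ∈ V₋, l ∈ H^{0,1} ⊓ V₊)}`. Proof: by naturality of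
`∧ ↦ ⌣` (`complexBetti_map_wedgeToCup`) `Λ(φ^*)` acts on `ĥ` by `d`; `φ^* = μ·J` with `J` the reflection of `V₊ ⊕ V₋`, so
`ΛJ ĥ = -ĥ` (`μ² = -d`) and `ĥ` is `(V₊, V₋)`-mixed (`mem_mixed_of_map_refl_eq_neg`); type `(1,1)` makes `ĥ` `(H^{1,0}, H^{0,1})`-mixed
(`HodgeModel.typePiece_eq_map_span_ιMulti_typed`); the blocks are Hodge-compatible (`eigenspace_eq_sup`); conclude by
`mem_span_weilGen_of_mixed_of_mixed`. Hence **`contractionRank_weilType_of_polarisation`**: THEOREM R on the real carriers for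
`A` of dimension `2n ≥ 6` of balanced Weil type `p_{i√d} = n`, with the h-part built on a `K`-symmetric `(1,1)`-class `h` that is
non-degenerate on `(H^{0,1})^⊥`, and NON-ZERO WEIL CLASSES `c± ∈ E±`: `contractionRank A κ = 4n² + n²·rank H₂(q) - 2n`.
Everything PROVED, 0 sorry.
References: [vanGeemen1994HodgeAV] 4.9, Lemma 5.2; [Deligne1982HodgeCycles] §4 (4.4), (4.8)(a); [BuchweitzFlenner2008HH] Prop. 6.4.4.
-/

noncomputable section

open CliffordAlgebra (contractLeft)
open ExteriorAlgebra (ι)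
open Module CategoryTheory
open Literature.AlgebraicGeometry.Motives Literature.AlgebraicGeometry.HodgeTheory
open Literature.AlgebraicTopology.SingularHomology

namespace Summit.Ventures.HSemireg.WeilFrame

open Summit.Ventures.HSemireg.Wedge.Hankel

/-! ### 1. Abstract: `Λ(f)` on `⋀²` through `exteriorPower.map`, and `Λ(μ·J) = μ²·ΛJ` in degree 2 -/

section Field

variable {K : Type*} [Field K] {V : Type*} [AddCommGroup V] [Module K V]

/-- `exteriorPower.map n f` is `ExteriorAlgebra.map f` on the degree-`n` piece. [cite: BourbakiAlgebre1a3, Ch. III §7 no. 2] -/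
theorem coe_exteriorPower_map {W : Type*} [AddCommGroup W] [Module K W] (f : V →ₗ[K] W) (n : ℕ) (x : ⋀[K]^n V) :
    ((exteriorPower.map n f x : ⋀[K]^n W) : ExteriorAlgebra K W) = ExteriorAlgebra.map f (x : ExteriorAlgebra K V) := by
  have h : (⋀[K]^n W).subtype ∘ₗ exteriorPower.map n f = (ExteriorAlgebra.map f).toLinearMap ∘ₗ (⋀[K]^n V).subtype := by
    refine exteriorPower.linearMap_ext ?_
    ext m
    simp only [LinearMap.compAlternatingMap_apply, LinearMap.coe_comp, Function.comp_apply, Submodule.subtype_apply,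
      exteriorPower.map_apply_ιMulti, exteriorPower.ιMulti_apply_coe, AlgHom.toLinearMap_apply,
      ExteriorAlgebra.map_apply_ιMulti]
  exact congrArg (fun g => g x) (congrArg DFunLike.coe h)

/-- if `f = c·J` pointwise, then on `⋀²`, `Λf = c²·ΛJ`. [cite: BourbakiAlgebre1a3, Ch. III §7 no. 2] -/
theorem map_eq_sq_smul_map_of_deg_two {f J : V →ₗ[K] V} {c : K} (hfJ : ∀ v, f v = c • J v) {x : ExteriorAlgebra K V}
    (hx : x ∈ ⋀[K]^2 V) : ExteriorAlgebra.map f x = (c * c) • ExteriorAlgebra.map J x := by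
  rw [← ExteriorAlgebra.ιMulti_span_fixedDegree] at hx
  induction hx using Submodule.span_induction with
  | mem z hz =>
    obtain ⟨v, rfl⟩ := hz
    rw [ExteriorAlgebra.map_apply_ιMulti, ExteriorAlgebra.map_apply_ιMulti, ExteriorAlgebra.ιMulti_apply,
      ExteriorAlgebra.ιMulti_apply]
    simp only [List.ofFn_succ, List.ofFn_zero, List.prod_cons, List.prod_nil, Function.comp_apply, hfJ, map_smul,
      smul_mul_assoc, mul_smul_comm, mul_one, smul_smul]
  | zero => rw [map_zero, map_zero, smul_zero]
  | add x y _ _ hx hy => rw [map_add, map_add, hx, hy, smul_add]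
  | smul t x _ hx => rw [map_smul, map_smul, hx, smul_comm]

/-- an endomorphism acting as `μ` on `P` and `-μ` on `Q` (`V = P ⊕ Q`) is `μ` times the reflection of `P ⊕ Q`. -/
theorem apply_eq_smul_refl_of_eigen {P Q : Submodule K V} (hPQ : IsCompl P Q) {f : V →ₗ[K] V} {μ : K}
    (hP : ∀ a ∈ P, f a = μ • a) (hQ : ∀ b ∈ Q, f b = -(μ • b)) (v : V) :
    f v = μ • LinearMap.ofIsCompl hPQ P.subtype (-Q.subtype) v := by
  have hv : v ∈ P ⊔ Q := by rw [hPQ.sup_eq_top]; exact Submodule.mem_top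
  obtain ⟨a, ha, b, hb, rfl⟩ := Submodule.mem_sup.mp hv
  rw [map_add, map_add, hP a ha, hQ b hb, refl_apply_of_mem_left hPQ ha, refl_apply_of_mem_right hPQ hb, smul_add, smul_neg]

end Field

/-! ### 2. Real carriers: a `K`-symmetric class of type `(1,1)` read in `ΛH¹` lies in the span of the Weil generating set -/

variable {A : AbelianVariety ℂ}

/-- **`K`-symmetry ⇒ `(V₊, V₋)`-mixed:** for `φ ≫ φ = -(d • 𝟙 A)`, `d ≥ 1`, `P = V₊`, `Q = V₋`, and `h ∈ H²(A(ℂ); ℂ)` with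
`φ^* h = d·h`, the class `h` read in `ΛH¹` lies in the span of the mixed products `ι a · ι b`, `a ∈ P, b ∈ Q` (or swapped).
[cite: vanGeemen1994HodgeAV, proof of Lemma 5.2 (6)] [cite: Deligne1982HodgeCycles, §4 (4.4)] -/
theorem exteriorOf_mem_mixed_of_kSymmetric {d : ℕ} (hd : 0 < d) {φ : A ⟶ A} (hφ : φ ≫ φ = -(d • 𝟙 A))
    {P Q : Submodule ℂ (complexBetti A.X 1)}
    (hP : P = Module.End.eigenspace (complexBetti.map φ.hom.hom.hom 1).hom (Complex.I * (Real.sqrt d : ℂ)))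
    (hQ : Q = Module.End.eigenspace (complexBetti.map φ.hom.hom.hom 1).hom (-(Complex.I * (Real.sqrt d : ℂ))))
    {h : complexBetti A.X 2} (hh : complexBetti.map φ.hom.hom.hom 2 h = (d : ℂ) • h) :
    ((⋀[ℂ]^2 (complexBetti A.X 1)).subtype ((abelianVarietyCohomologyExteriorH1_holds.equiv A 2).symm h)) ∈
      Submodule.span ℂ {z : ExteriorAlgebra ℂ (complexBetti A.X 1) | ∃ a b : complexBetti A.X 1,
        ((a ∈ P ∧ b ∈ Q) ∨ (a ∈ Q ∧ b ∈ P)) ∧ z = ι ℂ a * ι ℂ b} := by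
  set e := abelianVarietyCohomologyExteriorH1_holds.equiv A 2 with he
  set x := e.symm h with hxdef
  set T := (complexBetti.map φ.hom.hom.hom 1).hom with hT
  set μ : ℂ := Complex.I * (Real.sqrt d : ℂ) with hμ
  have hPQ : IsCompl P Q := by rw [hP, hQ]; exact isCompl_eigenspace_eigenspace_neg hd hφ
  -- (i) naturality: `Λ(φ^*) x = d • x` in `⋀²`
  have hmap : exteriorPower.map 2 T x = (d : ℂ) • x := by
    apply e.injective
    have h1 : e (exteriorPower.map 2 T x) = complexBetti.map φ.hom.hom.hom 2 (e x) := by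
      rw [abelianVarietyCohomologyExteriorH1.equiv_apply, abelianVarietyCohomologyExteriorH1.equiv_apply,
        complexBetti_map_wedgeToCup]
    rw [h1, map_smul, hxdef, LinearEquiv.apply_symm_apply, hh]
  have hmap' : ExteriorAlgebra.map T (x : ExteriorAlgebra ℂ (complexBetti A.X 1)) =
      (d : ℂ) • (x : ExteriorAlgebra ℂ (complexBetti A.X 1)) := by
    rw [← coe_exteriorPower_map, hmap, Submodule.coe_smul]
  -- (ii) `φ^* = μ·J` and `Λ(φ^*) = μ²·ΛJ = -d·ΛJ` on `⋀²`
  have hTJ : ∀ v, T v = μ • LinearMap.ofIsCompl hPQ P.subtype (-Q.subtype) v := by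
    refine apply_eq_smul_refl_of_eigen hPQ (fun a ha => ?_) (fun b hb => ?_)
    · rw [hP] at ha; exact Module.End.mem_eigenspace_iff.mp ha
    · rw [hQ] at hb; rw [← neg_smul]; exact Module.End.mem_eigenspace_iff.mp hb
  have hμ2 : μ * μ = -(d : ℂ) := by
    rw [hμ, mul_mul_mul_comm, Complex.I_mul_I, ← Complex.ofReal_mul, Real.mul_self_sqrt (Nat.cast_nonneg d),
      Complex.ofReal_natCast, neg_one_mul]
  have hJ : ExteriorAlgebra.map (LinearMap.ofIsCompl hPQ P.subtype (-Q.subtype)) (x : ExteriorAlgebra ℂ (complexBetti A.X 1)) =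
      -(x : ExteriorAlgebra ℂ (complexBetti A.X 1)) := by
    have h2 := map_eq_sq_smul_map_of_deg_two hTJ x.2
    rw [hmap', hμ2] at h2
    -- h2 : d • x = (-d) • ΛJ x
    have hd0 : (d : ℂ) ≠ 0 := Nat.cast_ne_zero.mpr (Nat.pos_iff_ne_zero.mp hd)
    have h3 : (d : ℂ) • (ExteriorAlgebra.map (LinearMap.ofIsCompl hPQ P.subtype (-Q.subtype)) (x : ExteriorAlgebra ℂ _) +
        (x : ExteriorAlgebra ℂ (complexBetti A.X 1))) = 0 := by
      rw [smul_add, h2, neg_smul, add_neg_cancel]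
    exact eq_neg_of_add_eq_zero_left ((smul_eq_zero.mp h3).resolve_left hd0)
  exact mem_mixed_of_map_refl_eq_neg hPQ two_ne_zero x.2 hJ

/-- **type `(1,1)` ⇒ `(H^{1,0}, H^{0,1})`-mixed:** a class `h ∈ H²(A(ℂ); ℂ)` of Hodge type `(1,1)` read in `ΛH¹` lies in the
span of the products `ι a · ι b`, `a ∈ H^{1,0}`, `b ∈ H^{0,1}` (or swapped) — the tree's `H^{1,1}(A) = H^{1,0} ∧ H^{0,1}`
(`HodgeModel.typePiece_eq_map_span_ιMulti_typed`). [cite: Lange2023AbelianVarietiesComplex, §1.1.5 Prop. 1.1.23]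
[cite: vanGeemen1994HodgeAV, 3.3] -/
theorem exteriorOf_mem_mixed_of_isOfHodgeType_one_one (hA : IsSmoothProjective A.dim A.X) {h : complexBetti A.X 2}
    (h11 : IsOfHodgeType A.dim A.X 2 1 1 h) :
    ((⋀[ℂ]^2 (complexBetti A.X 1)).subtype ((abelianVarietyCohomologyExteriorH1_holds.equiv A 2).symm h)) ∈
      Submodule.span ℂ {z : ExteriorAlgebra ℂ (complexBetti A.X 1) | ∃ a b : complexBetti A.X 1,
        ((a ∈ hodgeOneZero hA ∧ b ∈ hodgeZeroOne hA) ∨ (a ∈ hodgeZeroOne hA ∧ b ∈ hodgeOneZero hA)) ∧ z = ι ℂ a * ι ℂ b} := by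
  obtain ⟨B⟩ := nonempty_hodgeModel_holds.nonempty hA
  have hpq : ((1 : ℕ), (1 : ℕ)) ∈ Finset.HasAntidiagonal.antidiagonal 2 := Finset.HasAntidiagonal.mem_antidiagonal.mpr rfl
  have hmem := B.mem_typePiece_of_isOfHodgeType hodgePQ_independent_of_hodgeModel_holds hA hpq h11
  rw [HodgeModel.typePiece_eq_map_span_ιMulti_typed A B hA 2 ⟨((1 : ℕ), (1 : ℕ)), hpq⟩] at hmem
  obtain ⟨y, hy, hyh⟩ := hmem
  -- `y = (equiv)⁻¹ h` (the two comparison isomorphisms are the same map)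
  have hyx : (abelianVarietyCohomologyExteriorH1_holds.equiv A 2).symm h = y := by
    rw [LinearEquiv.symm_apply_eq]
    exact hyh.symm
  rw [hyx]
  -- transport the typed span through the inclusion `⋀² ⊆ ΛH¹`
  have hle : (Submodule.span ℂ {x : ⋀[ℂ]^2 (complexBetti A.X 1) |
      ∃ c : Fin 2 → complexBetti A.X 1, (∀ i : Fin 2, (i : ℕ) < 1 → c i ∈ hodgeOneZero hA) ∧
        (∀ i : Fin 2, 1 ≤ (i : ℕ) → c i ∈ hodgeZeroOne hA) ∧ exteriorPower.ιMulti ℂ 2 c = x}).map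
      (⋀[ℂ]^2 (complexBetti A.X 1)).subtype ≤
      Submodule.span ℂ {z : ExteriorAlgebra ℂ (complexBetti A.X 1) | ∃ a b : complexBetti A.X 1,
        ((a ∈ hodgeOneZero hA ∧ b ∈ hodgeZeroOne hA) ∨ (a ∈ hodgeZeroOne hA ∧ b ∈ hodgeOneZero hA)) ∧ z = ι ℂ a * ι ℂ b} := by
    rw [Submodule.map_span_le]
    rintro _ ⟨c, hc1, hc2, rfl⟩
    refine Submodule.subset_span ⟨c 0, c 1, Or.inl ⟨hc1 0 (by simp), hc2 1 (by simp)⟩, ?_⟩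
    rw [Submodule.subtype_apply, exteriorPower.ιMulti_apply_coe, ExteriorAlgebra.ιMulti_apply]
    simp [List.ofFn_succ]
  exact hle (Submodule.mem_map_of_mem hy)

/-- **a `K`-symmetric class of Hodge type `(1,1)` read in `ΛH¹` lies in the span of the WEIL GENERATING SET** of
`(H^{0,1}; V₊, V₋)` — the two properties of a `K`-compatible polarisation give the hypothesis `hΘ` of the frame theorems.
[cite: vanGeemen1994HodgeAV, 4.9 and Lemma 5.2] [cite: Deligne1982HodgeCycles, §4 (4.4) and (4.8)] -/
theorem exteriorOf_mem_span_weilGen (hA : IsSmoothProjective A.dim A.X) {d : ℕ} (hd : 0 < d) {φ : A ⟶ A}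
    (hφ : φ ≫ φ = -(d • 𝟙 A)) {P Q : Submodule ℂ (complexBetti A.X 1)}
    (hP : P = Module.End.eigenspace (complexBetti.map φ.hom.hom.hom 1).hom (Complex.I * (Real.sqrt d : ℂ)))
    (hQ : Q = Module.End.eigenspace (complexBetti.map φ.hom.hom.hom 1).hom (-(Complex.I * (Real.sqrt d : ℂ))))
    {h : complexBetti A.X 2} (hh : complexBetti.map φ.hom.hom.hom 2 h = (d : ℂ) • h) (h11 : IsOfHodgeType A.dim A.X 2 1 1 h) :
    ((⋀[ℂ]^2 (complexBetti A.X 1)).subtype ((abelianVarietyCohomologyExteriorH1_holds.equiv A 2).symm h)) ∈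
      Submodule.span ℂ {z : ExteriorAlgebra ℂ (complexBetti A.X 1) | ∃ x l : complexBetti A.X 1,
        ((x ∈ P ∧ l ∈ hodgeZeroOne hA ⊓ Q) ∨ (x ∈ Q ∧ l ∈ hodgeZeroOne hA ⊓ P)) ∧ z = ι ℂ x * ι ℂ l} := by
  have hPc : P ≤ P ⊓ hodgeOneZero hA ⊔ P ⊓ hodgeZeroOne hA := by rw [hP]; exact (eigenspace_eq_sup hA φ.hom.hom.hom _).le
  have hQc : Q ≤ Q ⊓ hodgeOneZero hA ⊔ Q ⊓ hodgeZeroOne hA := by rw [hQ]; exact (eigenspace_eq_sup hA φ.hom.hom.hom _).le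
  exact mem_span_weilGen_of_mixed_of_mixed (isCompl_hodgeOneZero_hodgeZeroOne hA) two_ne_zero hPc hQc
    (exteriorOf_mem_mixed_of_kSymmetric hd hφ hP hQ hh) (exteriorOf_mem_mixed_of_isOfHodgeType_one_one hA h11)

/-! ### 3. THEOREM R on the real carriers with the polarisation by its two properties -/

/-- **THEOREM R on the real carriers — Weil type `(n, n)`, the polarisation 2-vector by its properties** (`n ≥ 3`):
`A` a complex abelian variety of dimension `2n`; `φ : A ⟶ A`, `φ ≫ φ = -(d • 𝟙 A)`, `d ≥ 1`; `P = V₊`, `Q = V₋`; balanced type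
`p_{i√d} = n`; a class `h ∈ H²(A(ℂ); ℂ)` that is `K`-SYMMETRIC (`φ^* h = d·h`) and of HODGE TYPE `(1,1)`, whose reading `ĥ` in
`ΛH¹` is non-degenerate on `(H^{0,1})^⊥`; NON-ZERO WEIL CLASSES `c₊ ∈ E₊`, `c₋ ∈ E₋`; and total class
`Σ_{m ≤ 2n} (q_m/m!) ĥ^m + ĉ₊ + ĉ₋`. Then `contractionRank A κ = 4n² + n²·rank H₂(q) - 2n = (4 + ρ)n² - 2n`.
[cite: vanGeemen1994HodgeAV, 4.9 and Lemma 5.2] [cite: BuchweitzFlenner2008HH, Prop. 6.4.4] [cite: MumfordAV1970, §1 (4) and §4 (iii)] -/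
theorem contractionRank_weilType_of_polarisation (hA : IsSmoothProjective A.dim A.X)
    (κ : ∀ p : ℕ, complexBetti A.X (2 * p)) {n d : ℕ} (hn : 3 ≤ n) (hdim : A.dim = n + n) (hd : 0 < d) {φ : A ⟶ A}
    (hφ : φ ≫ φ = -(d • 𝟙 A)) {P Q : Submodule ℂ (complexBetti A.X 1)}
    (hP : P = Module.End.eigenspace (complexBetti.map φ.hom.hom.hom 1).hom (Complex.I * (Real.sqrt d : ℂ)))
    (hQ : Q = Module.End.eigenspace (complexBetti.map φ.hom.hom.hom 1).hom (-(Complex.I * (Real.sqrt d : ℂ))))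
    (hp : finrank ℂ ↥(P ⊓ hodgeOneZero hA) = n) {h : complexBetti A.X 2}
    (hh : complexBetti.map φ.hom.hom.hom 2 h = (d : ℂ) • h) (h11 : IsOfHodgeType A.dim A.X 2 1 1 h)
    (hnd : ∀ l ∈ (hodgeZeroOne hA : Set (complexBetti A.X 1)), ι ℂ l ∈ Submodule.span ℂ
      {y : ExteriorAlgebra ℂ (complexBetti A.X 1) |
        ∃ ψ ∈ {θ : Module.Dual ℂ (complexBetti A.X 1) | ∀ v ∈ hodgeZeroOne hA, θ v = 0}, y = contractLeft ψ
          ((⋀[ℂ]^2 (complexBetti A.X 1)).subtype ((abelianVarietyCohomologyExteriorH1_holds.equiv A 2).symm h))})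
    {cP cQ : complexBetti A.X (2 * n)} (hcP : cP ∈ weilClassesPlus A φ n d) (hcP0 : cP ≠ 0)
    (hcQ : cQ ∈ weilClassesMinus A φ n d) (hcQ0 : cQ ≠ 0) (q : ℕ → ℂ)
    (hx : totalExteriorClass A κ = (∑ m ∈ Finset.range (n + n + 1), (q m * ((m.factorial : ℕ) : ℂ)⁻¹) •
        ((⋀[ℂ]^2 (complexBetti A.X 1)).subtype ((abelianVarietyCohomologyExteriorH1_holds.equiv A 2).symm h)) ^ m) +
      (⋀[ℂ]^(2 * n) (complexBetti A.X 1)).subtype ((abelianVarietyCohomologyExteriorH1_holds.equiv A (2 * n)).symm cP) +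
      (⋀[ℂ]^(2 * n) (complexBetti A.X 1)).subtype ((abelianVarietyCohomologyExteriorH1_holds.equiv A (2 * n)).symm cQ)) :
    contractionRank A κ = ((4 * (n * n) + n * n * (hankel1 ℂ (n + n) 2 q).rank - 2 * n : ℕ) : Cardinal) :=
  contractionRank_weilType_of_weilClasses hA κ hn hdim hd hφ hP hQ hp (exteriorOf_mem_span_weilGen hA hd hφ hP hQ hh h11)
    hnd hcP hcP0 hcQ hcQ0 q hx

end Summit.Ventures.HSemireg.WeilFrame

end
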